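import Summits.BirchSwinnertonDyer.BirchSwinnertonDyer.Theorems.EisensteinPrimesBSDpOnCellCTelescopeCarrierSplit
import Summits.BirchSwinnertonDyer.BirchSwinnertonDyer.Theorems.SignedBaseChangeAnticyclotomicEisensteinDivisibilitySpecializationHerbrand
import HarnessLib

/-!
# Crux 4 `BSDpOnCellC` (stmt-BirchSwinnertonDyer-19034), line «telescope» v4: the in-file §E/§K2 glue of the K2 H-SPLIT as tree theorems —
# `carrierAlg_of_witness : <stub_carrierAlgW> → <stub_herbrandTranslate> → <v3's stub_carrierAlg text>` (module-level witness + one-sided Herbrand brick ⇒ the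
# algebraic carrier), with the inner-variable evaluation lemmas and `R₀⟦T⟧` factorial

Cell `bsd-eis`, successor LEAD `cruxlead-19034` g1; `--supports stmt-BirchSwinnertonDyer-19034`. MATHEMATICS AND LEAN TEXT: ideator `bsd-idea-12` g29
(`Cruxes/BSDpOnCellC/Lines/telescopeK2splitV3inline.lean` ace11b81c18e §E/§K2, critic idea-crit-14 V169), VERBATIM except the LEAD's binder-kind cure in `hHer`
(`UniqueFactorizationMonoid A → UniqueFactorizationMonoid B →` explicit, matching the REGISTERED `stub_herbrandTranslate` of telescope v4, sha256 645c0fbc…). Landing the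
glue makes the registered skeleton reducible to «imports + six stubs + one line» again (a successor's v5: delete §E/§K2 in `Lines/telescope.lean`, import this file, keep the
composition term with `TelescopeCarrierAlgOfWitness.carrierAlg_of_witness`).

* §E `evAtMap_map_C`, `evAtMap_C`, `evAtMap_pi`, `C_dvd_of_evAtMap_eq_zero`: coefficientwise evaluation of the INNER variable `X` at `a ∈ 𝔪` as the ring map
  `PowerSeries.map (AccumHelpers.evAt a ha).toRingHom : 𝒪⟦X⟧⟦T⟧ →+* 𝒪⟦T⟧` (x2-p2's `AccumHelpers.evAt`), a retraction of `C` with kernel `(C (X − C a))`.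
* `uniqueFactorizationMonoid_unrSeries`: `R₀⟦T⟧` is factorial (regular local of dimension 2; tree theorems).
* §K2 `carrierAlg_of_witness (hW : <stub_carrierAlgW>) (hHer : <stub_herbrandTranslate>) : <telescope v3 stub_carrierAlg VERBATIM>` — per member `k`: the evaluation
  retraction `φ_k` at `x_k`, the Herbrand brick with `π = C(X − C x_k)`, `N = 𝒩`, `char 𝒩 = (F)` ⇒ `char_{R₀⟦T⟧}(𝒩/(X − x_k)𝒩) ≤ (F(x_k,·))`; chain under the witness's
  one-sided control (ctrl_k); `Φ_k := F(x_k,·)`, `G_k := 1`, remainder = kernel property. Sorry-free.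

HONEST FRAMING: CONDITIONAL glue (both hypotheses are registered stubs: `stub_carrierAlgW` research XL, `stub_herbrandTranslate` bench M); nothing about any curve is asserted;
no summit statement / BSD / IMC / MC proved; 0 cells / labels / tiers move.

References (shape only): [Nekovar2006] §7.8, §8.9, §9.6; [Ochiai2006] §5, Lemma 7.2; [Delbourgo2008] Lemma 10.5, Prop. 10.10, Thm. 10.11; Bourbaki AC VII §4.4–4.5.
-/

set_option autoImplicit false
set_option linter.dupNamespace false

noncomputable section

open scoped Classical MatrixGroups ModularForm

open CongruenceSubgroup WeierstrassCurve NumberField IsDedekindDomain Field PowerSeries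
  Literature.NumberTheory.EllipticCurves Literature.NumberTheory.EllipticCurves.GreenbergSelmer
  Literature.NumberTheory.EllipticCurves.ModularForms Literature.NumberTheory.QuadraticFields
  Literature.NumberTheory.EllipticCurves.Rank1Residual
  Literature.NumberTheory.EllipticCurves.Rank1Residual.Typed
  Literature.NumberTheory.GaloisRepresentations Literature.NumberTheory.GaloisCohomology
  Summit.BirchSwinnertonDyer.Rank1Residual.X11b.AcSelmer
  Summit.BirchSwinnertonDyer.Rank1Residual.X11b.Halves
  Summit.BirchSwinnertonDyer.Rank1Residual.X11b
  Summit.BirchSwinnertonDyer.Rank1Residual Summit.BirchSwinnertonDyer.Rank1Residual.X1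
  Summit.BirchSwinnertonDyer.Rank1Residual.X2
open Literature.NumberTheory.EllipticCurves.BigGaloisRep
open Literature.NumberTheory.EllipticCurves.Castella2018

namespace Summit.BirchSwinnertonDyer.BirchSwinnertonDyer.Theorems.TelescopeCarrierAlgOfWitness

open Summit.BirchSwinnertonDyer.BirchSwinnertonDyer.Theorems

/-! ## §E Evaluating the inner (weight) variable at a point of the maximal ideal (theorems only) -/

section EvalInner

variable {𝒪 : Type*} [CommRing 𝒪] [IsLocalRing 𝒪] [IsAdicComplete (IsLocalRing.maximalIdeal 𝒪) 𝒪]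

/-! Coefficientwise evaluation of the INNER variable `X` at `a ∈ 𝔪` is the ring map
`PowerSeries.map (AccumHelpers.evAt a ha).toRingHom : 𝒪⟦X⟧⟦T⟧ →+* 𝒪⟦T⟧` (x2-p2's `AccumHelpers.evAt`, tree
`Theorems/EisensteinPrimesBSDpOnCellCAccumHelpersOne.lean` §Eval); four small facts about it (theorems only, no `def`). -/

/-- Evaluation of the inner variable is a retraction of `PowerSeries.map C`: `φ_a (C∘g) = g`. (Ideator bsd-idea-12 g29, §E.) [folklore] -/
theorem evAtMap_map_C (a : 𝒪) (ha : a ∈ IsLocalRing.maximalIdeal 𝒪) (g : PowerSeries 𝒪) :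
    PowerSeries.map (AccumHelpers.evAt a ha).toRingHom (PowerSeries.map (PowerSeries.C (R := 𝒪)) g) = g := by
  ext n
  simp only [PowerSeries.coeff_map, RingHom.coe_coe, AlgHom.toRingHom_eq_coe]
  exact AccumHelpers.evAt_C a ha _

/-- Evaluation of the inner variable on a constant (in the outer variable) series: `φ_a (C g) = C (g(a))`. [folklore] -/
theorem evAtMap_C (a : 𝒪) (ha : a ∈ IsLocalRing.maximalIdeal 𝒪) (g : PowerSeries 𝒪) :
    PowerSeries.map (AccumHelpers.evAt a ha).toRingHom (PowerSeries.C g) = PowerSeries.C (AccumHelpers.evAt a ha g) := by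
  rw [PowerSeries.map_C]
  rfl

/-- The evaluation map kills `C (X − C a)`. [folklore] -/
theorem evAtMap_pi (a : 𝒪) (ha : a ∈ IsLocalRing.maximalIdeal 𝒪) :
    PowerSeries.map (AccumHelpers.evAt a ha).toRingHom (PowerSeries.C (PowerSeries.X - PowerSeries.C a)) = 0 := by
  rw [evAtMap_C, map_sub, AccumHelpers.evAt_X, AccumHelpers.evAt_C, sub_self, map_zero]

/-- Kernel of the evaluation map: if `φ_a G = 0` then `C (X − C a) ∣ G` (coefficientwise `AccumHelpers.evAt_eq_zero_iff`). [folklore] -/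
theorem C_dvd_of_evAtMap_eq_zero (a : 𝒪) (ha : a ∈ IsLocalRing.maximalIdeal 𝒪)
    (G : PowerSeries (PowerSeries 𝒪)) (h : PowerSeries.map (AccumHelpers.evAt a ha).toRingHom G = 0) :
    PowerSeries.C (PowerSeries.X - PowerSeries.C a) ∣ G := by
  have hc : ∀ i, (PowerSeries.X - PowerSeries.C a) ∣ PowerSeries.coeff i G := by
    intro i
    rw [← AccumHelpers.evAt_eq_zero_iff a ha]
    have := congrArg (PowerSeries.coeff i) h
    rw [PowerSeries.coeff_map, map_zero] at this
    exact this
  choose q hq using hc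
  refine ⟨PowerSeries.mk q, PowerSeries.ext fun i => ?_⟩
  rw [PowerSeries.coeff_C_mul, PowerSeries.coeff_mk]
  exact hq i

end EvalInner

/-- `R₀⟦T⟧` is factorial (regular local of dimension 2: Auslander–Buchsbaum), from tree theorems. -/
theorem uniqueFactorizationMonoid_unrSeries (p : ℕ) [Fact p.Prime] :
    UniqueFactorizationMonoid (PowerSeries (unrIntegers p)) := by
  haveI := HidaLimitAlgebra.isDiscreteValuationRing_unrIntegers (p := p)
  haveI := Literature.NumberTheory.GaloisRepresentations.NearlyOrdinaryPresentationCA.isRegularLocalRing_mvPowerSeries_dvr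
    (unrIntegers p) 1
  exact Literature.AlgebraicGeometry.Resolution.uniqueFactorizationMonoid_of_isRegularLocalRing _
    (IsRegularLocalRing.of_ringEquiv (MvPowerSeries.renameEquiv (unrIntegers p) finOneEquiv.symm).toRingEquiv.symm)

set_option maxHeartbeats 1600000 in
/-- **KERNEL K2 (rebased on v3; statements inlined).** v3's `stub_carrierAlg` from the module-level witness (K2-W) and the Herbrand brick (K2-H): per member `k`,
apply K2-H to the evaluation retraction `φ_k = map (evAt x_k) : R₀⟦X⟧⟦T⟧ → R₀⟦T⟧` (kernel `(X − x_k)`), `π = X − x_k`, `N = 𝒩`; with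
`char 𝒩 = (F)` this is `char(𝒩/(X − x_k)𝒩) ≤ (F(x_k, T))`; push along `unrToCpInt` and chain under (ctrl_k): that is (alg_k) with
`Φ_k := F(x_k, T)`, `G_k := 1`, the remainder clause being the kernel property. Sorry-free. -/
theorem carrierAlg_of_witness
    (hW : ∀ (W : WeierstrassCurve ℚ) [W.IsElliptic] [W.IsGloballyMinimal] (p : ℕ) [Fact p.Prime],
    ∀ (N : ℕ) [NeZero N] (K : Type) [Field K] [NumberField K] (Dt : ModularParametrizationData W N)
      (H : HeegnerDatum N (NumberField.discr K)) (ιK : K →+* ℂ) (P : (W.baseChange K).toAffine.Point),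
      CellC W p → W.conductorNorm ℤ = N →
      IsImaginaryQuadratic K → NumberField.discr K < -4 → SatisfiesHeegnerHypothesis N K →
      (W.quadraticTwist (NumberField.discr K : ℚ)).entireLFunction 1 ≠ 0 →
      WeierstrassCurve.Affine.Point.map ιK.toRatAlgHom P = heegnerPointComplex Dt H →
      ¬ (p : ℤ) ∣ Dt.c → ¬ IsOfFinAddOrder P →
      Odd (NumberField.discr K) →
      ∀ (κ : ZpExtension K p), κ.IsAnticyclotomic →
        ∀ (γ : Field.absoluteGaloisGroup K) [Fact (κ.IsTopGenerator γ)]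
          (𝔭 : HeightOneSpectrum (𝓞 K)), ((p : ℕ) : 𝓞 K) ∈ 𝔭.asIdeal →
          𝔭.asIdeal.ramificationIdx (𝓞 ℚ) = 1 → 𝔭.asIdeal.inertiaDeg (𝓞 ℚ) = 1 →
          ∀ (𝔭bar : HeightOneSpectrum (𝓞 K)), ((p : ℕ) : 𝓞 K) ∈ 𝔭bar.asIdeal → 𝔭bar ≠ 𝔭 →
            ((Ideal.span {(p : ℤ)}).primesOver (𝓞 K)).ncard = 2 →
          ∀ (f : CuspForm (CongruenceSubgroup.Gamma0 N) 2), IsNewformOf W f →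
            ∀ (ι' : PadicAlgCl p ≃+* ℂ),
              (∀ (w : InfinitePlace K) (k : 𝓞 K),
                k ∈ 𝔭.asIdeal ↔ ‖ι'.symm (w.embedding (k : K))‖ < 1) →
              ∀ (ΩK : ℂ) (Ωp : ℂ_[p]) (Q : PowerSeries 𝓞_ℂ_[p]), ΩK ≠ 0 → ‖Ωp‖ = 1 →
                R1.IsBDPLFunctionInt p ι' 𝔭 κ γ f ΩK Ωp Q →
      ∀ (L : PowerSeries (PowerSeries (unrIntegers p))) (x : ℕ → ℤ_[p]) (D : ℕ → Skinner2016.HidaCongruentForm W p 1),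
        (∀ k, ‖x k‖ < 1) ∧ Filter.Tendsto x Filter.atTop (nhds 0) ∧
        (∃ e : ℕ, PowerSeries.C ((p : 𝓞_ℂ_[p]) ^ e) * Q ∈
          Ideal.span {PowerSeries.map (R1.unrToCpInt p) (PowerSeries.map (PowerSeries.constantCoeff (R := unrIntegers p)) L)}) ∧
        (∀ k : ℕ, (∀ y : coeffField (D k).g, ι' ((D k).ι y) = (y : ℂ)) ∧ 2 * ((p : ℤ) - 1) ∣ (D k).k - 2 ∧
          ∃ (ΩKg : ℂ) (Ωpg : ℂ_[p]) (Lg : UnrSeries p), ΩKg ≠ 0 ∧ ‖Ωpg‖ = 1 ∧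
            IsBDPLFunctionWt ι' 𝔭 κ γ (D k).g ΩKg Ωpg Lg ∧
          ∃ Ψ : UnrSeries p,
            (∃ U : PowerSeries (PowerSeries (unrIntegers p)),
              PowerSeries.map (PowerSeries.C (R := unrIntegers p)) Ψ =
                L + PowerSeries.C (PowerSeries.X - PowerSeries.C (toUnr p (x k))) * U) ∧
            (∃ e : ℕ, PowerSeries.C ((p : 𝓞_ℂ_[p]) ^ e) * PowerSeries.map (R1.unrToCpInt p) Ψ ∈
              Ideal.span {PowerSeries.map (R1.unrToCpInt p) Lg})) ∧
        (∃ A : ℕ → UnrSeries p, ∀ ℓ : ℕ, ℓ.Prime → ¬ ℓ ∣ N →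
          (∃ U : UnrSeries p, A ℓ = PowerSeries.C (toUnr p ((W.frobeniusTrace ℓ : ℤ) : ℤ_[p])) + PowerSeries.X * U) ∧
          ∀ k : ℕ, ∃ (c : unrIntegers p) (U : UnrSeries p),
            A ℓ = PowerSeries.C c + (PowerSeries.X - PowerSeries.C (toUnr p (x k))) * U ∧
            ((c : ℂ_[p]) = algebraMap (PadicAlgCl p) ℂ_[p]
              ((D k).ι ⟨(UpperHalfPlane.qExpansion 1 ⇑(D k).g).coeff ℓ, coeff_mem_coeffField (D k).g ℓ⟩))) →
      ∃ (F : PowerSeries (PowerSeries (unrIntegers p)))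
        (𝒩 : Type) (_ : AddCommGroup 𝒩) (_ : Module (PowerSeries (PowerSeries (unrIntegers p))) 𝒩)
        (_ : Module (PowerSeries (unrIntegers p)) 𝒩)
        (_ : IsScalarTower (PowerSeries (unrIntegers p)) (PowerSeries (PowerSeries (unrIntegers p))) 𝒩)
        (_ : Module.Finite (PowerSeries (PowerSeries (unrIntegers p))) 𝒩),
        Literature.NumberTheory.EllipticCurves.Module.charIdeal (PowerSeries (PowerSeries (unrIntegers p))) 𝒩 =
          Ideal.span {F} ∧
        ¬ (PowerSeries.C (PowerSeries.X : PowerSeries (unrIntegers p)) ∣ F) ∧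
        (∃ j : ℕ, PowerSeries.C ((p : 𝓞_ℂ_[p]) ^ j) *
            PowerSeries.map (R1.unrToCpInt p) (PowerSeries.map (PowerSeries.constantCoeff (R := unrIntegers p)) F) ∈
          (XAc.charIdeal (W.baseChange K) p κ 𝔭bar ∅ γ).map (PowerSeries.map (R1.toCpInt p))) ∧
        ∀ k : ℕ,
          (∃ s : PowerSeries (PowerSeries (unrIntegers p)),
            ¬ (PowerSeries.C (PowerSeries.X - PowerSeries.C (toUnr p (x k))) ∣ s) ∧ ∀ m : 𝒩, s • m = 0) ∧
          ∀ (b : padicCoeffIntegers (D k).ι →+* 𝓞_ℂ_[p]),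
            (∀ y, ((b y : 𝓞_ℂ_[p]) : ℂ_[p]) =
              algebraMap (PadicAlgCl p) ℂ_[p] (padicCoeffIntegers.toPadicAlgCl (D k).ι y)) →
          ∀ [TopologicalSpace (PowerSeries (padicCoeffIntegers (D k).ι))]
            [ContinuousSMul (PowerSeries (padicCoeffIntegers (D k).ι))
              (BigRepModule (padicCoeffIntegers (D k).ι) p (Cofree (D k).Δ.selfDualRep (padicCoeffField (D k).ι)))],
            ∃ j : ℕ, Ideal.span {PowerSeries.C ((p : 𝓞_ℂ_[p]) ^ j)} *
                (XBig.charIdeal κ ((D k).Δ.selfDualCofreeRepOver K) 𝔭bar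
                  (∅ : Set (HeightOneSpectrum (𝓞 K)))).map (PowerSeries.map b) ≤
              (Literature.NumberTheory.EllipticCurves.Module.charIdeal (PowerSeries (unrIntegers p))
                  (QuotSMulTop (PowerSeries.C (PowerSeries.X - PowerSeries.C (toUnr p (x k)))) 𝒩)).map
                (PowerSeries.map (R1.unrToCpInt p)))
    (hHer : ∀ (A B : Type) [CommRing A] [CommRing B] [IsDomain A] [IsDomain B] [IsNoetherianRing A] [IsNoetherianRing B]
      [Algebra A B], UniqueFactorizationMonoid A → UniqueFactorizationMonoid B →
    ∀ (π : B) (φ : B →+* A),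
      (∀ a : A, φ (algebraMap A B a) = a) → φ π = 0 → (∀ b : B, φ b = 0 → π ∣ b) →
    ∀ (N : Type) [AddCommGroup N] [Module B N] [Module A N] [IsScalarTower A B N] [Module.Finite B N],
      (∃ s : B, ¬ π ∣ s ∧ ∀ m : N, s • m = 0) →
      Literature.NumberTheory.EllipticCurves.Module.charIdeal A (QuotSMulTop π N) ≤
        (Literature.NumberTheory.EllipticCurves.Module.charIdeal B N).map φ) :
    ∀ (W : WeierstrassCurve ℚ) [W.IsElliptic] [W.IsGloballyMinimal] (p : ℕ) [Fact p.Prime],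
    ∀ (N : ℕ) [NeZero N] (K : Type) [Field K] [NumberField K] (Dt : ModularParametrizationData W N)
      (H : HeegnerDatum N (NumberField.discr K)) (ιK : K →+* ℂ) (P : (W.baseChange K).toAffine.Point),
      CellC W p → W.conductorNorm ℤ = N →
      IsImaginaryQuadratic K → NumberField.discr K < -4 → SatisfiesHeegnerHypothesis N K →
      (W.quadraticTwist (NumberField.discr K : ℚ)).entireLFunction 1 ≠ 0 →
      WeierstrassCurve.Affine.Point.map ιK.toRatAlgHom P = heegnerPointComplex Dt H →
      ¬ (p : ℤ) ∣ Dt.c → ¬ IsOfFinAddOrder P →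
      Odd (NumberField.discr K) →
      ∀ (κ : ZpExtension K p), κ.IsAnticyclotomic →
        ∀ (γ : Field.absoluteGaloisGroup K) [Fact (κ.IsTopGenerator γ)]
          (𝔭 : HeightOneSpectrum (𝓞 K)), ((p : ℕ) : 𝓞 K) ∈ 𝔭.asIdeal →
          𝔭.asIdeal.ramificationIdx (𝓞 ℚ) = 1 → 𝔭.asIdeal.inertiaDeg (𝓞 ℚ) = 1 →
          ∀ (𝔭bar : HeightOneSpectrum (𝓞 K)), ((p : ℕ) : 𝓞 K) ∈ 𝔭bar.asIdeal → 𝔭bar ≠ 𝔭 →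
            ((Ideal.span {(p : ℤ)}).primesOver (𝓞 K)).ncard = 2 →
          ∀ (f : CuspForm (CongruenceSubgroup.Gamma0 N) 2), IsNewformOf W f →
            ∀ (ι' : PadicAlgCl p ≃+* ℂ),
              (∀ (w : InfinitePlace K) (k : 𝓞 K),
                k ∈ 𝔭.asIdeal ↔ ‖ι'.symm (w.embedding (k : K))‖ < 1) →
              ∀ (ΩK : ℂ) (Ωp : ℂ_[p]) (Q : PowerSeries 𝓞_ℂ_[p]), ΩK ≠ 0 → ‖Ωp‖ = 1 →
                R1.IsBDPLFunctionInt p ι' 𝔭 κ γ f ΩK Ωp Q →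
      ∀ (L : PowerSeries (PowerSeries (unrIntegers p))) (x : ℕ → ℤ_[p]) (D : ℕ → Skinner2016.HidaCongruentForm W p 1),
        (∀ k, ‖x k‖ < 1) ∧ Filter.Tendsto x Filter.atTop (nhds 0) ∧
        (∃ e : ℕ, PowerSeries.C ((p : 𝓞_ℂ_[p]) ^ e) * Q ∈
          Ideal.span {PowerSeries.map (R1.unrToCpInt p) (PowerSeries.map (PowerSeries.constantCoeff (R := unrIntegers p)) L)}) ∧
        (∀ k : ℕ, (∀ y : coeffField (D k).g, ι' ((D k).ι y) = (y : ℂ)) ∧ 2 * ((p : ℤ) - 1) ∣ (D k).k - 2 ∧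
          ∃ (ΩKg : ℂ) (Ωpg : ℂ_[p]) (Lg : UnrSeries p), ΩKg ≠ 0 ∧ ‖Ωpg‖ = 1 ∧
            IsBDPLFunctionWt ι' 𝔭 κ γ (D k).g ΩKg Ωpg Lg ∧
          ∃ Ψ : UnrSeries p,
            (∃ U : PowerSeries (PowerSeries (unrIntegers p)),
              PowerSeries.map (PowerSeries.C (R := unrIntegers p)) Ψ =
                L + PowerSeries.C (PowerSeries.X - PowerSeries.C (toUnr p (x k))) * U) ∧
            (∃ e : ℕ, PowerSeries.C ((p : 𝓞_ℂ_[p]) ^ e) * PowerSeries.map (R1.unrToCpInt p) Ψ ∈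
              Ideal.span {PowerSeries.map (R1.unrToCpInt p) Lg})) ∧
        (∃ A : ℕ → UnrSeries p, ∀ ℓ : ℕ, ℓ.Prime → ¬ ℓ ∣ N →
          (∃ U : UnrSeries p, A ℓ = PowerSeries.C (toUnr p ((W.frobeniusTrace ℓ : ℤ) : ℤ_[p])) + PowerSeries.X * U) ∧
          ∀ k : ℕ, ∃ (c : unrIntegers p) (U : UnrSeries p),
            A ℓ = PowerSeries.C c + (PowerSeries.X - PowerSeries.C (toUnr p (x k))) * U ∧
            ((c : ℂ_[p]) = algebraMap (PadicAlgCl p) ℂ_[p]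
              ((D k).ι ⟨(UpperHalfPlane.qExpansion 1 ⇑(D k).g).coeff ℓ, coeff_mem_coeffField (D k).g ℓ⟩))) →
      ∃ F : PowerSeries (PowerSeries (unrIntegers p)),
        ¬ (PowerSeries.C (PowerSeries.X : PowerSeries (unrIntegers p)) ∣ F) ∧
        (∃ j : ℕ, PowerSeries.C ((p : 𝓞_ℂ_[p]) ^ j) *
            PowerSeries.map (R1.unrToCpInt p) (PowerSeries.map (PowerSeries.constantCoeff (R := unrIntegers p)) F) ∈
          (XAc.charIdeal (W.baseChange K) p κ 𝔭bar ∅ γ).map (PowerSeries.map (R1.toCpInt p))) ∧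
        ∀ k : ℕ, ∃ Φ : UnrSeries p,
          (∃ G U : PowerSeries (PowerSeries (unrIntegers p)),
            PowerSeries.map (PowerSeries.C (R := unrIntegers p)) Φ =
              F * G + PowerSeries.C (PowerSeries.X - PowerSeries.C (toUnr p (x k))) * U) ∧
          ∀ (b : padicCoeffIntegers (D k).ι →+* 𝓞_ℂ_[p]),
            (∀ y, ((b y : 𝓞_ℂ_[p]) : ℂ_[p]) =
              algebraMap (PadicAlgCl p) ℂ_[p] (padicCoeffIntegers.toPadicAlgCl (D k).ι y)) →
          ∀ [TopologicalSpace (PowerSeries (padicCoeffIntegers (D k).ι))]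
            [ContinuousSMul (PowerSeries (padicCoeffIntegers (D k).ι))
              (BigRepModule (padicCoeffIntegers (D k).ι) p (Cofree (D k).Δ.selfDualRep (padicCoeffField (D k).ι)))],
            ∃ j : ℕ, Ideal.span {PowerSeries.C ((p : 𝓞_ℂ_[p]) ^ j)} *
                (XBig.charIdeal κ ((D k).Δ.selfDualCofreeRepOver K) 𝔭bar
                  (∅ : Set (HeightOneSpectrum (𝓞 K)))).map (PowerSeries.map b) ≤
              Ideal.span {PowerSeries.map (R1.unrToCpInt p) Φ} := by
  intro W _ _ p _ N _ K _ _ Dt H ιK P hC hN hK hdisc hHeeg hL1 hP hc hfin hodd κ hκ γ _ 𝔭 h𝔭 hram hdeg 𝔭bar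
    h𝔭bar hne hsp f hf ι' hι' ΩK Ωp Q hΩK hΩp hQ L x D hpkg
  obtain ⟨F, 𝒩, _i1, _i2, _i3, _i4, _i5, hchar, hF, halg, hmem⟩ :=
    hW W p N K Dt H ιK P hC hN hK hdisc hHeeg hL1 hP hc hfin hodd κ hκ γ 𝔭 h𝔭 hram hdeg 𝔭bar h𝔭bar hne
      hsp f hf ι' hι' ΩK Ωp Q hΩK hΩp hQ L x D hpkg
  have hxk : ∀ k, ‖x k‖ < 1 := hpkg.1
  -- the receptacle `R₀ = unrIntegers p`: a complete DVR with uniformiser `p`; `R₀⟦T⟧`, `R₀⟦X⟧⟦T⟧` factorial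
  haveI := HidaLimitAlgebra.isDiscreteValuationRing_unrIntegers (p := p)
  haveI : IsAdicComplete (IsLocalRing.maximalIdeal (unrIntegers p)) (unrIntegers p) :=
    CongruentShaFreeCutUnrSeriesWeierstrass.isAdicComplete_maximalIdeal
  haveI : UniqueFactorizationMonoid (PowerSeries (PowerSeries (unrIntegers p))) :=
    Literature.NumberTheory.IwasawaTheory.uniqueFactorizationMonoid_powerSeries_powerSeries (unrIntegers p)
  haveI : UniqueFactorizationMonoid (PowerSeries (unrIntegers p)) := uniqueFactorizationMonoid_unrSeries p
  have hirr : Irreducible ((p : ℕ) : unrIntegers p) := HidaLimitAlgebra.irreducible_natCast_p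
  have hpmem : ((p : ℕ) : unrIntegers p) ∈ IsLocalRing.maximalIdeal (unrIntegers p) :=
    (IsLocalRing.mem_maximalIdeal _).mpr hirr.not_isUnit
  have hpt : ∀ z : ℤ_[p], ‖z‖ < 1 → toUnr p z ∈ IsLocalRing.maximalIdeal (unrIntegers p) := by
    intro z hz
    obtain ⟨y, hy⟩ := (PadicInt.norm_lt_one_iff_dvd z).mp hz
    rw [hy, map_mul, map_natCast]
    exact Ideal.mul_mem_right _ _ hpmem
  refine ⟨F, hF, halg, fun k => ?_⟩
  obtain ⟨⟨s, hsπ, hs⟩, hctrl⟩ := hmem k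
  have ha : toUnr p (x k) ∈ IsLocalRing.maximalIdeal (unrIntegers p) := hpt _ (hxk k)
  -- the evaluation retraction `φ_k : R₀⟦X⟧⟦T⟧ → R₀⟦T⟧`, `X ↦ x_k` (inner variable), kernel `(X - x_k)`
  let φ : PowerSeries (PowerSeries (unrIntegers p)) →+* PowerSeries (unrIntegers p) :=
    PowerSeries.map (AccumHelpers.evAt (toUnr p (x k)) ha).toRingHom
  have hφC : ∀ g : PowerSeries (unrIntegers p),
      φ (algebraMap (PowerSeries (unrIntegers p)) (PowerSeries (PowerSeries (unrIntegers p))) g) = g :=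
    fun g => evAtMap_map_C _ ha g
  have hφπ : φ (PowerSeries.C (PowerSeries.X - PowerSeries.C (toUnr p (x k)))) = 0 := evAtMap_pi _ ha
  have hφker : ∀ b : PowerSeries (PowerSeries (unrIntegers p)), φ b = 0 →
      PowerSeries.C (PowerSeries.X - PowerSeries.C (toUnr p (x k))) ∣ b :=
    fun b hb => C_dvd_of_evAtMap_eq_zero _ ha b hb
  -- ONE-SIDED HERBRAND at the member fibre: `char_{R₀⟦T⟧}(𝒩 / (X - x_k)𝒩) ⊆ (F(x_k, T))`
  have hle := hHer (PowerSeries (unrIntegers p)) (PowerSeries (PowerSeries (unrIntegers p)))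
    inferInstance inferInstance
    (PowerSeries.C (PowerSeries.X - PowerSeries.C (toUnr p (x k)))) φ hφC hφπ hφker 𝒩 ⟨s, hsπ, hs⟩
  rw [hchar, Ideal.map_span, Set.image_singleton] at hle
  refine ⟨φ F, ?_, ?_⟩
  · -- the fibre `Φ_k := F(x_k, T)` as a remainder: `Φ_k ≡ F (mod X - x_k)`
    obtain ⟨U, hU⟩ := hφker (PowerSeries.map (PowerSeries.C (R := unrIntegers p)) (φ F) - F) (by
      rw [map_sub, sub_eq_zero]
      exact hφC (φ F))
    exact ⟨1, U, by rw [mul_one, ← hU]; ring⟩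
  · intro b hb _ _
    obtain ⟨j, hj⟩ := hctrl b hb
    refine ⟨j, hj.trans ?_⟩
    have hle' := Ideal.map_mono (f := PowerSeries.map (R1.unrToCpInt p)) hle
    rwa [Ideal.map_span, Set.image_singleton] at hle'

end Summit.BirchSwinnertonDyer.BirchSwinnertonDyer.Theorems.TelescopeCarrierAlgOfWitness

end
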